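import Mathlib
import Literature.MathematicalPhysics.AQFT.OSAxiomsSchwinger
import Literature.MathematicalPhysics.QuantumLattice.SchwartzTensor
import HarnessLib

/-!
# `ContinuumLegGivenGap` (stmt-QuantumFields-15828) — negative-side support: the FULL-SEQUENCE
# skewness window is refuted for hypothesis-preserving twins (why `stub_skewWindow` is subsequential)

Support file for crux `stmt-QuantumFields-15828`
(`Summit.QuantumFields.YangMills.Theses.ConvexGribovBody.ContinuumLegGivenGap`), line `Sketch`, registered
negative sub-goal `stub_skewWindowFullSeqFalse`.  Tree objects only, nothing posited, no `def`; purely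
abstract (no lattice vocabulary is needed).

The four hypotheses (VS), (UVB), (ND), (CL) of the line's stub `stub_skewWindow` (= those of
`FlowLineStateSpace.CurvatureNonGaussianity`, stmt-9118) are invariant under the `k`-dependent bounded
rescaling of the free multiplicative renormalisation `c_k ↦ λ_k c_k`, `λ_k = 1` (`k` even), `λ_k = 2`
(`k` odd), of a species scheme, which multiplies the smeared three-point functional `LS k 3` by
`λ_k³ ∈ {1, 8}` ((UVB): `(α, β') ↦ (2α, β' + 1)`; (ND): `λ_k² ≥ 1`; (CL): `C ↦ 2^{n+m} C`; (VS) does not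
see `c`).  A conclusion of the stub must therefore be stable under `LS k ↦ λ_k³ LS k`.

* `twin_obstruction`: a convergent complex sequence times the alternating factor `λ_k³`, divided by a
  fixed weight, is not eventually within `‖s‖/4` of any `s ≠ 0`.
* `twinWindow_fails`: hence the FULL-SEQUENCE window clause `∀ ε > 0, ∀ᶠ j, ∀ᶠ k, ‖λ_k³ LS k (F₃ j)/w_j − s₃‖ ≤ ε`
  fails for every family `LS` converging pointwise on the tensors `F₃ j`, every `s₃ ≠ 0` and all weights.
* `stub_skewWindowFullSeqFalse` (registered): the reshape-7 conclusion of `stub_skewWindow`, written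
  verbatim for the twin family `k ↦ (if Even k then 1 else 8) * LS k`, is FALSE whenever `LS` converges
  pointwise on off-diagonal three-point tensors (the intended situation: a continuum limit, or the diagonal
  subsequence of the socket stmt-15926) — so the full-sequence stub would have exploded its own UV package.
* `skewWindowSubseq_twin_stable`: the reshape-8 (SUBSEQUENTIAL) clause `∃ s₃ ≠ 0, ∃ φ ↑, ∀ ε, ∀ᶠ j, ∀ᶠ k,
  ‖LS (φ k) (F₃ j)/w_j − s₃‖ ≤ ε` IS twin-stable: pass to the parity class cofinal in `φ`, `s₃ ↦ λ³ s₃`. [folklore]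
-/

noncomputable section

open scoped SchwartzMap
open Filter Topology
open Literature.MathematicalPhysics.AQFT Literature.MathematicalPhysics.QuantumLattice

namespace Summit.QuantumFields.YangMills.Theorems.ContinuumLegGivenGap.Negative

/-- Even indices are cofinal in `ℕ`. [folklore] -/
theorem frequently_even_atTop : ∃ᶠ k : ℕ in atTop, Even k :=
  frequently_atTop.2 fun N => ⟨2 * N, by omega, even_two_mul N⟩

/-- Odd indices are cofinal in `ℕ`. [folklore] -/
theorem frequently_not_even_atTop : ∃ᶠ k : ℕ in atTop, ¬ Even k :=
  frequently_atTop.2 fun N => ⟨2 * N + 1, by omega, Nat.not_even_iff_odd.2 (odd_two_mul_add_one N)⟩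

/-- **Core inequality (the twin obstruction).** A convergent complex sequence `x_k → a`, multiplied by the
alternating cube factor `λ_k³` (`1` for even `k`, `8` for odd `k`) and divided by a fixed weight `w`, is not
eventually within `‖s‖/4` of a non-zero `s`: the two cofinal parity classes would put both `a/w` and
`8a/w` within `‖s‖/4` of `s`, whence `7‖a/w‖ ≤ ‖s‖/2` and `‖s‖ ≤ ‖s‖/4 + ‖a/w‖`, absurd. [folklore] -/
theorem twin_obstruction {x : ℕ → ℂ} {a s : ℂ} (hx : Tendsto x atTop (𝓝 a)) (hs : s ≠ 0) {w : ℝ}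
    (h : ∀ᶠ k in atTop, ‖(if Even k then (1 : ℂ) else 8) * x k / (w : ℂ) - s‖ ≤ ‖s‖ / 4) : False := by
  have hy : Tendsto (fun k => x k / (w : ℂ)) atTop (𝓝 (a / w)) := hx.div_const _
  have hC : IsClosed {z : ℂ | ‖z - s‖ ≤ ‖s‖ / 4} :=
    isClosed_le (continuous_id.sub continuous_const).norm continuous_const
  have hC8 : IsClosed {z : ℂ | ‖8 * z - s‖ ≤ ‖s‖ / 4} :=
    isClosed_le ((continuous_const.mul continuous_id).sub continuous_const).norm continuous_const
  have h1 : ‖a / w - s‖ ≤ ‖s‖ / 4 := by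
    refine hC.mem_of_frequently_of_tendsto ?_ hy
    refine (frequently_even_atTop.and_eventually h).mono ?_
    rintro k ⟨hk, hk'⟩
    simpa [hk] using hk'
  have h2 : ‖8 * (a / w) - s‖ ≤ ‖s‖ / 4 := by
    refine hC8.mem_of_frequently_of_tendsto ?_ hy
    refine (frequently_not_even_atTop.and_eventually h).mono ?_
    rintro k ⟨hk, hk'⟩
    have : ‖8 * x k / (w : ℂ) - s‖ ≤ ‖s‖ / 4 := by simpa [hk] using hk'
    simpa [mul_div_assoc] using this
  have h3 : 7 * ‖a / w‖ ≤ ‖s‖ / 2 := by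
    have : (7 : ℂ) * (a / w) = (8 * (a / w) - s) - (a / w - s) := by ring
    calc 7 * ‖a / w‖ = ‖(7 : ℂ) * (a / w)‖ := by simp
      _ = ‖(8 * (a / w) - s) - (a / w - s)‖ := by rw [this]
      _ ≤ ‖8 * (a / w) - s‖ + ‖a / w - s‖ := norm_sub_le _ _
      _ ≤ ‖s‖ / 2 := by linarith
  have h4 : ‖s‖ ≤ ‖a / w - s‖ + ‖a / w‖ := by
    simpa [norm_neg] using norm_sub_le (a / w - s) (a / w)
  have hs' : 0 < ‖s‖ := norm_pos_iff.2 hs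
  nlinarith

/-- **The full-sequence window fails for the twin family** (abstract, `∀`-form): for every family of
functionals `LS k` converging pointwise on the test objects `F₃ j`, every `s₃ ≠ 0` and all weights `w j`,
the clause `∀ ε > 0, ∀ᶠ j, ∀ᶠ k, ‖λ_k³ LS k (F₃ j) / w_j − s₃‖ ≤ ε` is false (take `ε = ‖s₃‖/4`, one `j`,
and `twin_obstruction`). [folklore] -/
theorem twinWindow_fails {α : Type*} (LS : ℕ → α → ℂ) (F₃ : ℕ → α)
    (hconv : ∀ j, ∃ a : ℂ, Tendsto (fun k => LS k (F₃ j)) atTop (𝓝 a)) {s₃ : ℂ} (hs : s₃ ≠ 0)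
    (w : ℕ → ℝ) :
    ¬ ∀ ε : ℝ, 0 < ε → ∀ᶠ j in atTop, ∀ᶠ k in atTop,
        ‖(if Even k then (1 : ℂ) else 8) * LS k (F₃ j) / (w j : ℂ) - s₃‖ ≤ ε := by
  intro hwin
  obtain ⟨j, hj⟩ := (hwin (‖s₃‖ / 4) (by positivity)).exists
  obtain ⟨a, ha⟩ := hconv j
  exact twin_obstruction ha hs hj

/-- **`stub_skewWindowFullSeqFalse`** (registered negative sub-goal of stmt-QuantumFields-15828, line
`Sketch`): the FULL-SEQUENCE skewness-window clause — the reshape-7 conclusion of `stub_skewWindow`,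
verbatim, for the twin family `k ↦ (if Even k then 1 else 8) * LS k` — is false for EVERY abstract family
`LS : ℕ → 𝓢((ℝ⁴)³, ℂ) → ℂ` of three-point functionals converging pointwise on off-diagonal tensors, every
`s₃ ≠ 0`, all one-point sequences, tensors and positive weights.  For the concrete Wilson functionals the
twin is the functional of the scheme `{sch with c := λ • sch.c}`, which satisfies (VS), (UVB), (ND), (CL)
whenever `sch` does; so the full-sequence form of the stub would refute the existence of any scheme with
the four hypotheses and pointwise-convergent three-point functionals (the socket's own output).  This is
why reshape 8 concludes along a subsequence `φ` (`skewWindowSubseq_twin_stable`). [folklore] -/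
theorem stub_skewWindowFullSeqFalse :
    ∀ LS : ℕ → SchwartzMap (Fin 3 → EuclideanSpace ℝ (Fin 4)) ℂ → ℂ,
      (∀ F : SchwartzMap (Fin 3 → EuclideanSpace ℝ (Fin 4)) ℂ, IsOffDiagonal F →
        ∃ a : ℂ, Tendsto (fun k => LS k F) atTop (𝓝 a)) →
      ¬ ∃ (s₃ : ℂ) (f g h : ℕ → SchwartzMap (EuclideanSpace ℝ (Fin 4)) ℂ)
          (F₃ : ℕ → SchwartzMap (Fin 3 → EuclideanSpace ℝ (Fin 4)) ℂ) (w : ℕ → ℝ),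
          s₃ ≠ 0 ∧ (∀ j, 0 < w j) ∧ (∀ j, IsTensorOf (F₃ j) ![f j, g j, h j] ∧ IsOffDiagonal (F₃ j)) ∧
            ∀ ε : ℝ, 0 < ε → ∀ᶠ j in atTop, ∀ᶠ k in atTop,
              ‖(if Even k then (1 : ℂ) else 8) * LS k (F₃ j) / (w j : ℂ) - s₃‖ ≤ ε := by
  rintro LS hconv ⟨s₃, f, g, h, F₃, w, hs, -, hF, hwin⟩
  exact twinWindow_fails LS F₃ (fun j => hconv (F₃ j) (hF j).2) hs w hwin

/-- **The subsequential clause is twin-stable** (design rationale of reshape 8, abstract): if the window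
holds for `LS` along a strictly increasing `φ` with limit `s₃ ≠ 0`, then for the twin family
`k ↦ (if Even k then 1 else 8) * LS k` it holds along the further subsequence `φ ∘ ψ` picking the parity
class of `φ k` that is cofinal, with limit `s₃` (even class) or `8 s₃` (odd class). [folklore] -/
theorem skewWindowSubseq_twin_stable {α : Type*} (LS : ℕ → α → ℂ) (F₃ : ℕ → α) (w : ℕ → ℝ)
    {s₃ : ℂ} (hs : s₃ ≠ 0) {φ : ℕ → ℕ} (hφ : StrictMono φ)
    (hwin : ∀ ε : ℝ, 0 < ε → ∀ᶠ j in atTop, ∀ᶠ k in atTop, ‖LS (φ k) (F₃ j) / (w j : ℂ) - s₃‖ ≤ ε) :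
    ∃ (s₃' : ℂ) (φ' : ℕ → ℕ), s₃' ≠ 0 ∧ StrictMono φ' ∧
      ∀ ε : ℝ, 0 < ε → ∀ᶠ j in atTop, ∀ᶠ k in atTop,
        ‖(if Even (φ' k) then (1 : ℂ) else 8) * LS (φ' k) (F₃ j) / (w j : ℂ) - s₃'‖ ≤ ε := by
  by_cases he : ∃ᶠ k in atTop, Even (φ k)
  · obtain ⟨ψ, hψ, hψe⟩ := extraction_of_frequently_atTop he
    refine ⟨s₃, φ ∘ ψ, hs, hφ.comp hψ, fun ε hε => ?_⟩
    filter_upwards [hwin ε hε] with j hj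
    filter_upwards [hψ.tendsto_atTop.eventually hj] with k hk
    show ‖(if Even (φ (ψ k)) then (1 : ℂ) else 8) * LS (φ (ψ k)) (F₃ j) / (w j : ℂ) - s₃‖ ≤ ε
    rw [if_pos (hψe k), one_mul]
    exact hk
  · obtain ⟨ψ, hψ, hψo⟩ := extraction_of_eventually_atTop (not_frequently.1 he)
    refine ⟨8 * s₃, φ ∘ ψ, mul_ne_zero (by norm_num) hs, hφ.comp hψ, fun ε hε => ?_⟩
    filter_upwards [hwin (ε / 8) (by positivity)] with j hj
    filter_upwards [hψ.tendsto_atTop.eventually hj] with k hk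
    show ‖(if Even (φ (ψ k)) then (1 : ℂ) else 8) * LS (φ (ψ k)) (F₃ j) / (w j : ℂ) - 8 * s₃‖ ≤ ε
    rw [if_neg (hψo k)]
    have hfac : (8 : ℂ) * LS (φ (ψ k)) (F₃ j) / (w j : ℂ) - 8 * s₃ =
        8 * (LS (φ (ψ k)) (F₃ j) / (w j : ℂ) - s₃) := by ring
    have h8n : ‖(8 : ℂ)‖ = 8 := by simp
    rw [hfac, norm_mul, h8n]
    linarith

end Summit.QuantumFields.YangMills.Theorems.ContinuumLegGivenGap.Negative

end
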